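import Summits.MatrixMultiplication.OmegaCensus.DominoStructureTPP
import Summits.MatrixMultiplication.OmegaCensus.RadonProjection
import HarnessLib

/-!
# The shifted reduced form of a domino cube law triple (ANY finite abelian `A`) and its Radon identity

ω-census `pub-omega`, family (b3), seat pub-omega-group gen 7.  Framing: lottery ticket; floor = certified bounds/negative
ranges.  VALUE: kernel form of the even-order reduction R8.1 of `THEORY-radon-g7.md` (the reduction future engines for
|A| = 352, 400, 484, … need); NOT progress on ω.

**Theorem (`domino_shifted_form_of_law`).** Dihedral-like `G` over a finite abelian `A` (any `c₀`, any parity); a TPP triple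
with coset parts `(1,1 | d,d | e,e)` attaining `3|S||T||U| + 8 = 8|A|`.  Then there are `X, Y ⊆ A` (`|X| = d`, `|Y| = e`),
shifts `β, γ ∈ A` and a point `x₀` such that `X + Y` is direct and the three sets `X + Y`, `β + (Y − X)`, `γ + (X − Y)`
are pairwise disjoint with union `A ∖ {x₀}`.  (For odd `|A|` one can reach `β = γ = 0`: `DominoSymmetricForm.lean`; for
even `|A|` only the classes of `β, γ` modulo `2A` are invariants.)

**Theorem (`radon_identity_shifted`).** For such data and any homomorphism `φ : A →+ B`, every `t ∈ B` satisfies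
`Σ_u (n_X(t−u) + n_X(u−(t−φβ)) + n_X((t−φγ)+u)) · n_Y(u) + [φ x₀ = t] = |φ⁻¹(t)|` — identity (L) with two shifts.
-/

namespace Summit.MatrixMultiplication.OmegaCensus

open Literature.Combinatorics.Additive Finset

section Shifted

variable {A B : Type*} [AddCommGroup A] [DecidableEq A] [AddCommGroup B] [Fintype B] [DecidableEq B]

omit [Fintype B] in
/-- Fibre of a translate: `|(c + Z) ∩ φ⁻¹(t)| = |Z ∩ φ⁻¹(t − φ c)|`. [folklore] -/
theorem card_filter_image_add_eq (φ : A →+ B) (Z : Finset A) (c : A) (t : B) :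
    ((Z.image fun z => z + c).filter fun a => φ a = t).card = (Z.filter fun a => φ a = t - φ c).card := by
  rw [filter_image, card_image_of_injective _ (add_left_injective c)]
  congr 1; ext z
  simp only [mem_filter, map_add]
  constructor
  · rintro ⟨hz, h⟩; exact ⟨hz, by rw [← h, add_sub_cancel_right]⟩
  · rintro ⟨hz, h⟩; exact ⟨hz, by rw [h, sub_add_cancel]⟩

variable [Fintype A]

/-- **Radon identity with shifts** (even-order form of (L)). [folklore] -/
theorem radon_identity_shifted (φ : A →+ B) {X Y : Finset A} {β γ x₀ : A}
    (hinj : Set.InjOn (fun p : A × A => p.1 + p.2) ↑(X ×ˢ Y))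
    (hPQ : Disjoint ((X ×ˢ Y).image fun p : A × A => p.1 + p.2)
      (((Y ×ˢ X).image fun p : A × A => p.1 - p.2).image fun z => z + β))
    (hPR : Disjoint ((X ×ˢ Y).image fun p : A × A => p.1 + p.2)
      (((X ×ˢ Y).image fun p : A × A => p.1 - p.2).image fun z => z + γ))
    (hQR : Disjoint (((Y ×ˢ X).image fun p : A × A => p.1 - p.2).image fun z => z + β)
      (((X ×ˢ Y).image fun p : A × A => p.1 - p.2).image fun z => z + γ))
    (hcover : ((X ×ˢ Y).image fun p : A × A => p.1 + p.2) ∪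
      (((Y ×ˢ X).image fun p : A × A => p.1 - p.2).image fun z => z + β) ∪
      (((X ×ˢ Y).image fun p : A × A => p.1 - p.2).image fun z => z + γ) = univ.erase x₀) (t : B) :
    (∑ u : B, ((X.filter fun a => φ a = t - u).card + (X.filter fun a => φ a = u - (t - φ β)).card +
        (X.filter fun a => φ a = (t - φ γ) + u).card) * (Y.filter fun a => φ a = u).card) +
      (if φ x₀ = t then 1 else 0) = (univ.filter fun a : A => φ a = t).card := by
  set P := (X ×ˢ Y).image fun p : A × A => p.1 + p.2
  set Q := ((Y ×ˢ X).image fun p : A × A => p.1 - p.2).image fun z => z + β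
  set R := ((X ×ˢ Y).image fun p : A × A => p.1 - p.2).image fun z => z + γ
  have hsum : (∑ u : B, ((X.filter fun a => φ a = t - u).card + (X.filter fun a => φ a = u - (t - φ β)).card +
        (X.filter fun a => φ a = (t - φ γ) + u).card) * (Y.filter fun a => φ a = u).card) =
      (P.filter fun a => φ a = t).card + (Q.filter fun a => φ a = t).card + (R.filter fun a => φ a = t).card := by
    rw [card_fibre_sumset φ hinj, card_filter_image_add_eq, card_fibre_diffset φ hinj, card_filter_image_add_eq,
      card_fibre_diffset' φ hinj, ← sum_add_distrib, ← sum_add_distrib]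
    exact sum_congr rfl fun u _ => by ring
  rw [hsum]
  have hdPQ : Disjoint (P.filter fun a => φ a = t) (Q.filter fun a => φ a = t) := disjoint_filter_filter hPQ
  have hdPR : Disjoint (P.filter fun a => φ a = t) (R.filter fun a => φ a = t) := disjoint_filter_filter hPR
  have hdQR : Disjoint (Q.filter fun a => φ a = t) (R.filter fun a => φ a = t) := disjoint_filter_filter hQR
  have hunion : (univ.filter fun a : A => φ a = t) =
      ((P ∪ Q ∪ R).filter fun a => φ a = t) ∪ (({x₀} : Finset A).filter fun a => φ a = t) := by
    rw [← filter_union, hcover]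
    congr 1
    ext a
    simp only [mem_union, mem_erase, mem_univ, mem_singleton, and_true]
    tauto
  have hdisj0 : Disjoint ((P ∪ Q ∪ R).filter fun a => φ a = t) (({x₀} : Finset A).filter fun a => φ a = t) := by
    apply disjoint_filter_filter
    rw [hcover, disjoint_singleton_right]
    exact fun h => (mem_erase.1 h).1 rfl
  rw [hunion, card_union_of_disjoint hdisj0, filter_union, filter_union,
    card_union_of_disjoint (disjoint_union_left.2 ⟨hdPR, hdQR⟩), card_union_of_disjoint hdPQ]
  congr 1
  rw [filter_singleton]
  split_ifs <;> simp

end Shifted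

section DihedralLike

variable {A : Type*} [AddCommGroup A] [DecidableEq A] [Fintype A] {G : Type} [Group G] [DecidableEq G]
  {ρ τ : A → G} {c₀ : A} {S T U : Finset G}

omit [Fintype A] in
/-- Image of a difference set under a translation of the first factor. [folklore] -/
theorem diffset_image_add_left (c : A) (Y X : Finset A) :
    (((Y.image fun y => y + c) ×ˢ X).image fun p : A × A => p.1 - p.2) =
      ((Y ×ˢ X).image fun p : A × A => p.1 - p.2).image (fun z => z + c) := by
  ext z
  simp only [mem_image, mem_product, Prod.exists]
  constructor
  · rintro ⟨y', x, ⟨⟨y, hy, rfl⟩, hx⟩, rfl⟩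
    exact ⟨y - x, ⟨y, x, ⟨hy, hx⟩, rfl⟩, by abel⟩
  · rintro ⟨w, ⟨y, x, ⟨hy, hx⟩, rfl⟩, rfl⟩
    exact ⟨y + c, x, ⟨⟨y, hy, rfl⟩, hx⟩, by abel⟩

omit [Fintype A] in
/-- Image of a difference set under a translation of the second factor. [folklore] -/
theorem diffset_image_add_right (c : A) (X Y : Finset A) :
    ((X ×ˢ (Y.image fun y => y + c)).image fun p : A × A => p.1 - p.2) =
      ((X ×ˢ Y).image fun p : A × A => p.1 - p.2).image (fun z => z + -c) := by
  ext z
  simp only [mem_image, mem_product, Prod.exists]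
  constructor
  · rintro ⟨x, y', ⟨hx, ⟨y, hy, rfl⟩⟩, rfl⟩
    exact ⟨x - y, ⟨x, y, ⟨hx, hy⟩, rfl⟩, by abel⟩
  · rintro ⟨w, ⟨x, y, ⟨hx, hy⟩, rfl⟩, rfl⟩
    exact ⟨x, y + c, ⟨hx, ⟨y, hy, rfl⟩⟩, by abel⟩

omit [Fintype A] in
/-- A sumset with a reflected first factor is a translate of a difference set. [folklore] -/
theorem sumset_reflect_left (κ : A) (X Y : Finset A) :
    (((X.image fun x => κ - x) ×ˢ Y).image fun p : A × A => p.1 + p.2) =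
      ((Y ×ˢ X).image fun p : A × A => p.1 - p.2).image (fun z => z + κ) := by
  ext z
  simp only [mem_image, mem_product, Prod.exists]
  constructor
  · rintro ⟨x', y, ⟨⟨x, hx, rfl⟩, hy⟩, rfl⟩
    exact ⟨y - x, ⟨y, x, ⟨hy, hx⟩, rfl⟩, by abel⟩
  · rintro ⟨w, ⟨y, x, ⟨hy, hx⟩, rfl⟩, rfl⟩
    exact ⟨κ - x, y, ⟨⟨x, hx, rfl⟩, hy⟩, by abel⟩

omit [Fintype A] in
/-- A sumset with a reflected second factor is a translate of a difference set. [folklore] -/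
theorem sumset_reflect_right (κ : A) (X Y : Finset A) :
    ((X ×ˢ (Y.image fun y => κ - y)).image fun p : A × A => p.1 + p.2) =
      ((X ×ˢ Y).image fun p : A × A => p.1 - p.2).image (fun z => z + κ) := by
  ext z
  simp only [mem_image, mem_product, Prod.exists]
  constructor
  · rintro ⟨x, y', ⟨hx, ⟨y, hy, rfl⟩⟩, rfl⟩
    exact ⟨x - y, ⟨x, y, ⟨hx, hy⟩, rfl⟩, by abel⟩
  · rintro ⟨w, ⟨x, y, ⟨hx, hy⟩, rfl⟩, rfl⟩
    exact ⟨x, κ - y, ⟨hx, ⟨y, hy, rfl⟩⟩, by abel⟩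

/-- **Shifted reduced form of a domino cube law triple (any `A`).** [folklore] -/
theorem domino_shifted_form_of_law
    (hρρ : ∀ a b, ρ a * ρ b = ρ (a + b)) (hρτ : ∀ a b, ρ a * τ b = τ (b - a))
    (hτρ : ∀ a b, τ a * ρ b = τ (a + b)) (hττ : ∀ a b, τ a * τ b = ρ (c₀ + b - a))
    (hρ : Function.Injective ρ) (hτ : Function.Injective τ) (hne : ∀ a b, ρ a ≠ τ b)
    (hsurj : ∀ g, (∃ a, ρ a = g) ∨ (∃ a, τ a = g))
    (h : TripleProductProperty S T U)
    (hS₀ : (univ.filter fun a : A => ρ a ∈ S).card = 1) (hS₁ : (univ.filter fun a : A => τ a ∈ S).card = 1)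
    (hT : (univ.filter fun a : A => ρ a ∈ T).card = (univ.filter fun a : A => τ a ∈ T).card)
    (hU : (univ.filter fun a : A => ρ a ∈ U).card = (univ.filter fun a : A => τ a ∈ U).card)
    (hV : 3 * (S.card * T.card * U.card) + 8 = 8 * Fintype.card A) :
    ∃ (X Y : Finset A) (β γ x₀ : A), X.card = (univ.filter fun a : A => ρ a ∈ T).card ∧
      Y.card = (univ.filter fun a : A => ρ a ∈ U).card ∧
      Set.InjOn (fun p : A × A => p.1 + p.2) ↑(X ×ˢ Y) ∧
      Disjoint ((X ×ˢ Y).image fun p : A × A => p.1 + p.2)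
        (((Y ×ˢ X).image fun p : A × A => p.1 - p.2).image fun z => z + β) ∧
      Disjoint ((X ×ˢ Y).image fun p : A × A => p.1 + p.2)
        (((X ×ˢ Y).image fun p : A × A => p.1 - p.2).image fun z => z + γ) ∧
      Disjoint (((Y ×ˢ X).image fun p : A × A => p.1 - p.2).image fun z => z + β)
        (((X ×ˢ Y).image fun p : A × A => p.1 - p.2).image fun z => z + γ) ∧
      ((X ×ˢ Y).image fun p : A × A => p.1 + p.2) ∪
        (((Y ×ˢ X).image fun p : A × A => p.1 - p.2).image fun z => z + β) ∪
        (((X ×ˢ Y).image fun p : A × A => p.1 - p.2).image fun z => z + γ) = univ.erase x₀ := by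
  set T₀ : Finset A := univ.filter fun a => ρ a ∈ T with hT₀
  set T₁ : Finset A := univ.filter fun a => τ a ∈ T with hT₁
  set U₀ : Finset A := univ.filter fun a => ρ a ∈ U with hU₀
  set U₁ : Finset A := univ.filter fun a => τ a ∈ U with hU₁
  obtain ⟨κ, κ', hκ, hκ'⟩ := domino_structure_of_law hρρ hρτ hτρ hττ hρ hτ hne hsurj h hS₀ hS₁ hT hU hV
  obtain ⟨s, hs⟩ := card_eq_one.1 hS₀
  obtain ⟨s', hs'⟩ := card_eq_one.1 hS₁
  have mS₀ : ∀ a ∈ ({s} : Finset A), ρ a ∈ S := fun a ha => by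
    have : a ∈ univ.filter fun a : A => ρ a ∈ S := by rw [hs]; exact ha
    simpa using this
  have mS₁ : ∀ a ∈ ({s'} : Finset A), τ a ∈ S := fun a ha => by
    have : a ∈ univ.filter fun a : A => τ a ∈ S := by rw [hs']; exact ha
    simpa using this
  have mS₀c : ∀ a ∈ ({s} : Finset A), cond false (τ a) (ρ a) ∈ S := fun a ha => by simpa using mS₀ a ha
  have mS₁c : ∀ a ∈ ({s'} : Finset A), cond true (τ a) (ρ a) ∈ S := fun a ha => by simpa using mS₁ a ha
  have mT₀ : ∀ a ∈ T₀, ρ a ∈ T := fun a ha => by simpa [hT₀] using ha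
  have mT₁ : ∀ a ∈ T₁, τ a ∈ T := fun a ha => by simpa [hT₁] using ha
  have mU₀ : ∀ a ∈ U₀, ρ a ∈ U := fun a ha => by simpa [hU₀] using ha
  have mU₁ : ∀ a ∈ U₁, τ a ∈ U := fun a ha => by simpa [hU₁] using ha
  have mT₀c : ∀ a ∈ T₀, cond false (τ a) (ρ a) ∈ T := fun a ha => by simpa using mT₀ a ha
  have mT₁c : ∀ a ∈ T₁, cond true (τ a) (ρ a) ∈ T := fun a ha => by simpa using mT₁ a ha
  have mU₀c : ∀ a ∈ U₀, cond false (τ a) (ρ a) ∈ U := fun a ha => by simpa using mU₀ a ha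
  have mU₁c : ∀ a ∈ U₁, cond true (τ a) (ρ a) ∈ U := fun a ha => by simpa using mU₁ a ha
  have cS := card_eq_parts' hρ hτ hne hsurj S
  have cT := card_eq_parts' hρ hτ hne hsurj T
  have cU := card_eq_parts' hρ hτ hne hsurj U
  rw [hS₀, hS₁] at cS
  have hprod : S.card * T.card * U.card = 8 * (T₀.card * U₀.card) := by
    rw [cS, cT, cU, ← hT, ← hU]; ring
  rw [hprod] at hV
  have hn : 3 * (T₀.card * U₀.card) + 1 = Fintype.card A := by omega
  have inj := sum_injOn' hρρ hττ hρ hτ h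
  have i₀₀ := injOn₂_of_injOn₃_singleton s' T₀ U₀ (inj true false false mS₁c mT₀c mU₀c)
  have i₁₀ := injOn₂_of_injOn₃_singleton s T₁ U₀ (inj false true false mS₀c mT₁c mU₀c)
  have i₀₁ := injOn₂_of_injOn₃_singleton s T₀ U₁ (inj false false true mS₀c mT₀c mU₁c)
  have d₁ := disjoint_sumset₁' hρρ hρτ hτρ hττ hne h false mS₁ mT₀ mU₀c mS₀ mT₁
  have d₃ := disjoint_sumset₂' hρρ hρτ hτρ hττ hne h false mS₀c mT₁ mU₀ mS₀c mT₀ mU₁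
  have d₂ := disjoint_sumset₃' hρρ hρτ hτρ hττ hne h false mS₀ mT₀c mU₁ mS₁ mU₀
  rw [sumset₃_singleton, sumset₃_singleton] at d₁ d₂ d₃
  have hκ1 : T₁ = T₀.image (fun t => κ - t) := hκ
  have hκ'1 : U₁ = U₀.image (fun u => κ' - u) := hκ'
  rw [hκ1] at d₁ d₃ i₁₀
  rw [hκ'1] at d₂ d₃ i₀₁
  set B1 := ((T₀ ×ˢ U₀).image fun p : A × A => p.1 + p.2).image (fun z => z + s') with hB1
  set B2 := (((T₀.image fun t => κ - t) ×ˢ U₀).image fun p : A × A => p.1 + p.2).image (fun z => z + s) with hB2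
  set B3 := ((T₀ ×ˢ (U₀.image fun u => κ' - u)).image fun p : A × A => p.1 + p.2).image (fun z => z + s) with hB3
  have cB1 : B1.card = T₀.card * U₀.card := by
    rw [hB1, card_image_of_injective _ (add_left_injective s'), card_sumset₂ i₀₀]
  have cB2 : B2.card = T₀.card * U₀.card := by
    rw [hB2, card_image_of_injective _ (add_left_injective s), card_sumset₂ i₁₀,
      card_image_of_injective _ (sub_right_injective)]
  have cB3 : B3.card = T₀.card * U₀.card := by
    rw [hB3, card_image_of_injective _ (add_left_injective s), card_sumset₂ i₀₁,
      card_image_of_injective _ (sub_right_injective)]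
  obtain ⟨x₁, hx₁⟩ := exists_missed_point d₁ d₂.symm d₃ (by rw [cB1, cB2, cB3]; omega)
  have hcov : B1 ∪ B2 ∪ B3 = univ.erase x₁ := by
    ext a
    have ha := congrArg (fun s : Finset A => a ∈ s) hx₁
    simp only [mem_sdiff, mem_univ, true_and, mem_singleton, eq_iff_iff] at ha
    simp only [mem_erase, mem_univ, and_true]
    tauto
  -- X := T₀, Y := U₀ + s' : then B1 = X + Y, B2 = (Y − X) + (κ + s − s'), B3 = (X − Y) + (κ' + s + s')
  set Y : Finset A := U₀.image fun y => y + s' with hY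
  have eP : ((T₀ ×ˢ Y).image fun p : A × A => p.1 + p.2) = B1 := by
    rw [hY, sumset₂_image_add_right]
  have eQ : ((Y ×ˢ T₀).image fun p : A × A => p.1 - p.2).image (fun z => z + (κ + s - s')) = B2 := by
    rw [hY, diffset_image_add_left, image_add_image_add, hB2, sumset_reflect_left, image_add_image_add]
    congr 1; funext z; abel_nf
  have eR : ((T₀ ×ˢ Y).image fun p : A × A => p.1 - p.2).image (fun z => z + (κ' + s + s')) = B3 := by
    rw [hY, diffset_image_add_right, image_add_image_add, hB3, sumset_reflect_right, image_add_image_add]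
    congr 1; funext z; abel_nf
  refine ⟨T₀, Y, κ + s - s', κ' + s + s', x₁, rfl, ?_, ?_, ?_, ?_, ?_, ?_⟩
  · rw [hY, card_image_of_injective _ (add_left_injective s')]
  · exact injOn_sumset₂_image_add_right s' i₀₀
  · rw [eP, eQ]; exact d₁
  · rw [eP, eR]; exact d₂.symm
  · rw [eQ, eR]; exact d₃
  · rw [eP, eQ, eR]; exact hcov

end DihedralLike

end Summit.MatrixMultiplication.OmegaCensus
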